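import Summits.Ventures.CertifiedManyBodySolver.Observables.RungLeavesCoverageNdNiO2Residual
import Summits.Ventures.CertifiedManyBodySolver.Certificates.HubbardSquare_NdM21CutBoxE_stiffness_kinematic
import HarnessLib

/-!
# Ventures/CertifiedManyBodySolver — Observables/RungLeavesCoverageNdNiO2ResidualCut.lean

HONEST FRAMING: one-sided certified CEILINGS on the uniform flux stiffness on the DOWNFOLDED d⁹-nickelate boxes of record `boxNdNiO2E_M21`
(NdNiO₂ parent film) and `boxNdSrNiO2E_M22` (Nd₀.₈Sr₀.₂NiO₂) — wording class (xx1): CONTROL / CALIBRATION + labelled heuristic; a ceiling never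
speaks to the presence of superconductivity; a downfolded box is a systematic modelling claim (router/BOXES/NdNiO2.md «1BH+3BE»); never «certified
true negative / positive»; not a `T_c` or phase-diagram statement; no summit statement is proved here. Prop-level CLOSERS only, CONDITIONAL BY NAME on
the certified ROWS and CAPS they name; the kinematic cover pieces are KERNEL theorems already in the tree (zero solve); no number of record is asserted;
no `sorry`; no definition.

Cells `pub/hubbard-obs` ∧ `pub/hubbard-downfold` (MO-S2, D-0154 (1)(C) COVERAGE material (iii) NdNiO₂), seat `hubbard-cov-ndnio2-box-1`
(`prover-hubbard-cov-ndnio2-box-1-0`; obs RULING (nnn) d310 (nnn7) «claim-node SHAPES + one-`exact` closers when certificates exist»). THE CLAIM-NODE-SHAPE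
INSTANCES of `Observables/RungLeavesCoverageNdNiO2Residual.lean` §3 at the kinematic cover OF RECORD TODAY — `t′`-cut `t_s = −11/25` (seat box-2's «KINCOVER»
leaves `Certificates.ndM21CutBoxE_stiffnessSeqLeaf` `0.4768946 <` bar `0.4779578`, `ndM22CutBoxE_stiffnessSeqLeaf` `0.4389096 < 0.4418857`) and density cuts
`n_s = 9/10` (M21; hubbard-tc p1's `Certificates.ndBoxE_parent_stiffnessSeqLeaf`, `0.4736879`) / `n_s = 393/500` (M22; `ndBoxE_sr025_stiffnessSeqLeaf`, `0.4414575`).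
The CELL-LEAF reductions to the residual corner boxes `[−23/50, −11/25] × [5, 17/2] × [9/10, 477/500]` (M21) and `… × [359/500, 409/500]` (M22, deep sliver) and
the FAMILY-form station closers are seat box-2's `Observables/RungLeavesCoverageNdNiO2Cut.lean` (`NdNiO2M21_StiffnessBoxCeiling_of_cornerCellLeaf`,
`…_of_cornerApexStation5_twoEndObjectives`, …) — not restated here. THIS file states what the CERTIFICATE NODES must say:

* §1 M21 — `NdNiO2M21_StiffnessBoxCeiling_of_residualStation5Rows_cut11o25_n9o10`: for every density `x ∈ [9/10, 477/500]` and every source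
  `s ∈ [−276/425, −11/25]` at the station `U_A = 5`, certified `D₄`-orbit-lower ROWS `rP x s` on `−X₀(−23/50, 5)` and `rT x s` on `−X₀(−11/25, 5)`
  (`SquareTTPrimeCorrOrbitLowerRow s 5 x (u x s) (r· x s) univ Λ₇ (−X₀(·, 5))`) under certified CAPS `e₀(1, s, 5, x) ≤ u x s`, the negated σ-chord
  `≤ c ≤ 0.4779578` ⇒ the rung leaf «MOS2-ndnio2-M21». Interval-valid certificates only (boxdual bundle / box-row nodes quantified over the segment × the density
  interval; hubbard-cov-ndnio2-ref-1 flags f1/f2); the CAP table `u` is today's missing input (sdp-1 W1).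
* §2 M22 — the residual-cover glue `stiffnessBoxCeilingBelow_boxNdSrNiO2E_M22_of_residualCover` (three cell leaves, `t_s`, `n_s` free) and the rows + caps instance
  `NdNiO2M22_StiffnessBoxCeiling_of_residualStation5Rows_cut11o25_n393o500` on `s ∈ [−276/425, −11/25] × x ∈ [393/500, 409/500]` (residual = `1/5` of the `t′` entry ×
  `8/25` of the filling entry; cover pieces `ndM22CutBoxE_stiffnessSeqLeaf` and `ndBoxE_sr025_stiffnessSeqLeaf`, margin of the latter `0.0004282` under the bar).

References: D. J. Scalapino, S. R. White, S.-C. Zhang, PRB 47 (1993) 7995, §II [ScalapinoWhiteZhang1993]; T. Koma, H. Tasaki, J. Stat. Phys. 76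
(1994) 745, §1 [KomaTasaki1994]; T. Hazra, N. Verma, M. Randeria, PRX 9 (2019) 031049, eqs. (2)–(6) [HazraVermaRanderia2019].
-/

noncomputable section

namespace Summit.Ventures.CertifiedManyBodySolver.Observables

open Set NonemptyInterval Filter Topology
open Summit.Ventures.CertifiedManyBodySolver.Downfold
open Summit.Ventures.CertifiedManyBodySolver.Certificates
open Literature.MathematicalPhysics.QuantumLattice Literature.MathematicalPhysics.QuantumLattice.ThermodynamicLimit
open Literature.Probability.LatticeModels
open Matrix HubbardWave0
open scoped BigOperators ComplexOrder

/-! ## §1 NdNiO₂ parent (M21): the rung leaf from station-`5` ROWS + CAPS on the residual segment `[−276/425, −11/25] × [9/10, 477/500]` -/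

/-- **THE RUNG LEAF FROM THE STATION-`5` ROWS + CAPS ON THE RESIDUAL SEGMENT (claim-node shape, by name).** For every density `x ∈ [9/10, 477/500]` and
every source `s ∈ [−276/425, −11/25]` at `U_A = 5`: certified `D₄`-orbit-lower ROWS `rP x s` on `−X₀(−23/50, 5)` and `rT x s` on `−X₀(−11/25, 5)` under a
certified CAP `e₀(1, s, 5, x) ≤ u x s`; the negated σ-chord `−((−11/25 − σ)·rP + (σ + 23/50)·rT)/(1/50) ≤ c` for `σ ∈ [−23/50, −11/25]`, `s ∈ [24σ/17, σ]`;
`c ≤ 0.4779578` ⇒ `NdNiO2M21_StiffnessBoxCeiling`. The shallow-`t′` piece (`ndM21CutBoxE_stiffnessSeqLeaf`, `0.4768946`) and the low-filling piece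
(`ndBoxE_parent_stiffnessSeqLeaf`, `0.4736879`) are kernel kinematics below the bar, by name; NO `K₂` input, no lever.
[cite: KomaTasaki1994, §1] [cite: ScalapinoWhiteZhang1993, §II] -/
theorem NdNiO2M21_StiffnessBoxCeiling_of_residualStation5Rows_cut11o25_n9o10 {c : ℚ} (u rP rT : ℝ → ℝ → ℚ)
    (hrowP : ∀ x ∈ Set.Icc (9 / 10 : ℝ) (477 / 500), ∀ s ∈ Set.Icc (-(276 / 425) : ℝ) (-11 / 25),
      SquareTTPrimeCorrOrbitLowerRow s 5 x (u x s) (rP x s) Finset.univ (Literature.Probability.LatticeModels.box 2 7)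
        (-oddMomentObsTT (-23 / 50) 5 0))
    (hrowT : ∀ x ∈ Set.Icc (9 / 10 : ℝ) (477 / 500), ∀ s ∈ Set.Icc (-(276 / 425) : ℝ) (-11 / 25),
      SquareTTPrimeCorrOrbitLowerRow s 5 x (u x s) (rT x s) Finset.univ (Literature.Probability.LatticeModels.box 2 7)
        (-oddMomentObsTT (-11 / 25) 5 0))
    (hcap : ∀ x ∈ Set.Icc (9 / 10 : ℝ) (477 / 500), ∀ s ∈ Set.Icc (-(276 / 425) : ℝ) (-11 / 25),
      energyDensityTT' 1 s 5 x ≤ ((u x s : ℚ) : ℝ))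
    (hprice : ∀ x ∈ Set.Icc (9 / 10 : ℝ) (477 / 500), ∀ σ ∈ Set.Icc (-23 / 50 : ℝ) (-11 / 25), ∀ s ∈ Set.Icc (σ * (24 / 17)) σ,
      -((-11 / 25 - σ) / (-11 / 25 - -23 / 50) * ((rP x s : ℚ) : ℝ) + (σ - -23 / 50) / (-11 / 25 - -23 / 50) * ((rT x s : ℚ) : ℝ)) ≤
        ((c : ℚ) : ℝ))
    (hc : c ≤ 4779578 / 10000000) :
    NdNiO2M21_StiffnessBoxCeiling := by
  obtain ⟨e, eP, -⟩ := ndnio2_M21_station5_geometry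
  exact NdNiO2M21_StiffnessBoxCeiling_of_residualStation5Rows_and_kinCover (ts := -11 / 25) (ns := 9 / 10) (cT := 4768946 / 10000000)
    (cN := 4736879 / 10000000) (by norm_num) (by norm_num) (by norm_num) u rP rT
    (fun x hx s hs => hrowP x hx s (by rwa [e, eP] at hs)) (fun x hx s hs => hrowT x hx s (by rwa [e, eP] at hs))
    (fun x hx s hs => hcap x hx s (by rwa [e, eP] at hs)) (fun x hx σ hσ s hs => hprice x hx σ hσ s (by rwa [e] at hs))
    hc (by norm_num) (by norm_num)
    (fun _ htp _ _ _ hn => ndM21CutBoxE_stiffnessSeqLeaf htp (by linarith [hn.1]) hn.2)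
    (fun _ htp _ _ _ hn => ndBoxE_parent_stiffnessSeqLeaf ⟨htp.1, by linarith [htp.2]⟩ (by linarith [hn.1]) hn.2)

/-! ## §2 Nd₀.₈Sr₀.₂NiO₂ (M22): residual-cover glue and the rows + caps instance on `[−276/425, −11/25] × [393/500, 409/500]` -/

/-- **Residual cover glue for the twin** (bar-parametric): cell leaves `c_R` on `[−23/50, t_s] × [5, 17/2] × [n_s, 409/500]`, `c_T` on `[t_s, −9/25] × … × [359/500, 409/500]`,
`c_N` on `[−23/50, t_s] × … × [359/500, n_s]`, all `≤ bar` ⇒ `StiffnessBoxCeilingBelow boxNdSrNiO2E_M22 bar` (word `max c_R (max c_T c_N)`).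
[cite: ScalapinoWhiteZhang1993, §II] -/
theorem stiffnessBoxCeilingBelow_boxNdSrNiO2E_M22_of_residualCover {bar cR cT cN : ℚ} {ts ns : ℝ} (hcR : cR ≤ bar) (hcT : cT ≤ bar)
    (hcN : cN ≤ bar)
    (hR : ∀ tp ∈ Set.Icc (-23 / 50 : ℝ) ts, ∀ U ∈ Set.Icc (5 : ℝ) (17 / 2), ∀ n ∈ Set.Icc ns (409 / 500),
      ObsStiffnessSeqCeilingAt tp U n cR)
    (hT : ∀ tp ∈ Set.Icc ts (-9 / 25), ∀ U ∈ Set.Icc (5 : ℝ) (17 / 2), ∀ n ∈ Set.Icc (359 / 500 : ℝ) (409 / 500),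
      ObsStiffnessSeqCeilingAt tp U n cT)
    (hN : ∀ tp ∈ Set.Icc (-23 / 50 : ℝ) ts, ∀ U ∈ Set.Icc (5 : ℝ) (17 / 2), ∀ n ∈ Set.Icc (359 / 500 : ℝ) ns,
      ObsStiffnessSeqCeilingAt tp U n cN) :
    StiffnessBoxCeilingBelow boxNdSrNiO2E_M22 bar := by
  refine stiffnessBoxCeilingBelow_boxNdSrNiO2E_M22_of_cellLeaf (c := max cR (max cT cN)) (max_le hcR (max_le hcT hcN))
    fun tp htp U hU n hn => ?_
  rcases le_total tp ts with ht | ht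
  · rcases le_total ns n with hn' | hn'
    · exact (hR tp ⟨htp.1, ht⟩ U hU n ⟨hn', hn.2⟩).mono (le_max_left _ _)
    · exact (hN tp ⟨htp.1, ht⟩ U hU n ⟨hn.1, hn'⟩).mono ((le_max_right cT cN).trans (le_max_right cR _))
  · exact (hT tp ⟨ht, htp.2⟩ U hU n hn).mono ((le_max_left cT cN).trans (le_max_right cR _))

/-- **THE TWIN LEAF FROM THE STATION-`5` ROWS + CAPS ON ITS RESIDUAL SEGMENT (claim-node shape, by name).** For every density `x ∈ [393/500, 409/500]` and every
source `s ∈ [−276/425, −11/25]` at `U_A = 5`: certified orbit-lower ROWS `rP x s` on `−X₀(−23/50, 5)`, `rT x s` on `−X₀(−11/25, 5)` under certified CAPS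
`e₀(1, s, 5, x) ≤ u x s`; the negated σ-chord `≤ c ≤ 0.4418857` ⇒ `NdNiO2M22_StiffnessBoxCeiling` (cover pieces `ndM22CutBoxE_stiffnessSeqLeaf` `0.4389096` and
`ndBoxE_sr025_stiffnessSeqLeaf` `0.4414575`, both below the bar, by name). [cite: KomaTasaki1994, §1] [cite: ScalapinoWhiteZhang1993, §II] -/
theorem NdNiO2M22_StiffnessBoxCeiling_of_residualStation5Rows_cut11o25_n393o500 {c : ℚ} (u rP rT : ℝ → ℝ → ℚ)
    (hrowP : ∀ x ∈ Set.Icc (393 / 500 : ℝ) (409 / 500), ∀ s ∈ Set.Icc (-(276 / 425) : ℝ) (-11 / 25),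
      SquareTTPrimeCorrOrbitLowerRow s 5 x (u x s) (rP x s) Finset.univ (Literature.Probability.LatticeModels.box 2 7)
        (-oddMomentObsTT (-23 / 50) 5 0))
    (hrowT : ∀ x ∈ Set.Icc (393 / 500 : ℝ) (409 / 500), ∀ s ∈ Set.Icc (-(276 / 425) : ℝ) (-11 / 25),
      SquareTTPrimeCorrOrbitLowerRow s 5 x (u x s) (rT x s) Finset.univ (Literature.Probability.LatticeModels.box 2 7)
        (-oddMomentObsTT (-11 / 25) 5 0))
    (hcap : ∀ x ∈ Set.Icc (393 / 500 : ℝ) (409 / 500), ∀ s ∈ Set.Icc (-(276 / 425) : ℝ) (-11 / 25),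
      energyDensityTT' 1 s 5 x ≤ ((u x s : ℚ) : ℝ))
    (hprice : ∀ x ∈ Set.Icc (393 / 500 : ℝ) (409 / 500), ∀ σ ∈ Set.Icc (-23 / 50 : ℝ) (-11 / 25), ∀ s ∈ Set.Icc (σ * (24 / 17)) σ,
      -((-11 / 25 - σ) / (-11 / 25 - -23 / 50) * ((rP x s : ℚ) : ℝ) + (σ - -23 / 50) / (-11 / 25 - -23 / 50) * ((rT x s : ℚ) : ℝ)) ≤
        ((c : ℚ) : ℝ))
    (hc : c ≤ 4418857 / 10000000) :
    NdNiO2M22_StiffnessBoxCeiling := by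
  obtain ⟨e, eP, -⟩ := ndnio2_M21_station5_geometry
  refine stiffnessBoxCeilingBelow_boxNdSrNiO2E_M22_of_residualCover (ts := -11 / 25) (ns := 393 / 500) (cT := 4389096 / 10000000)
    (cN := 4414575 / 10000000) hc (by norm_num) (by norm_num) (fun tp htp U hU n hn => ?_)
    (fun _ htp _ _ _ hn => ndM22CutBoxE_stiffnessSeqLeaf ⟨htp.1, by linarith [htp.2]⟩ (by linarith [hn.1]) hn.2)
    (fun _ htp _ _ _ hn => ndBoxE_sr025_stiffnessSeqLeaf ⟨htp.1, by linarith [htp.2]⟩ (by linarith [hn.1]) hn.2)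
  refine ObsStiffnessSeqCeilingAt_on_box3_of_apexStation_twoEndObjectives (p := -23 / 50) (q := -11 / 25) (UA := 5) (Umax := 17 / 2)
    (n₁ := 393 / 500) (n₂ := 409 / 500) (by norm_num) (by norm_num) (by norm_num) (by norm_num) (by norm_num)
    (fun x s => ((rP x s : ℚ) : ℝ)) (fun x s => ((rT x s : ℚ) : ℝ)) c
    (fun x hx s hs => orbitLower_of_orbitLowerRow_of_cap (hrowP x hx s (by rwa [e, eP] at hs)) (hcap x hx s (by rwa [e, eP] at hs)))
    (fun x hx s hs => orbitLower_of_orbitLowerRow_of_cap (hrowT x hx s (by rwa [e, eP] at hs)) (hcap x hx s (by rwa [e, eP] at hs)))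
    (fun x hx σ hσ s hs => hprice x hx σ hσ s (by rwa [e] at hs)) tp htp U hU n hn

end Summit.Ventures.CertifiedManyBodySolver.Observables

end
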